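import Summits.Ventures.HodgeKum4.FixedLocus
import Summits.Ventures.HodgeKum4.Theorems.KummerFixedLocusCoinvariantsLLVTrivial
import Summits.Ventures.HodgeKum4.Theorems.KummerFixedLocusDefs
import Summits.Ventures.HodgeKum4.Theorems.KummerFixedLocusFixedFourfoldPD
import Summits.Ventures.HodgeKum4.Theorems.KummerFixedLocusGSignature
import Summits.Ventures.HodgeKum4.Theorems.KummerFixedLocusOrientationPreserved
import Summits.Ventures.HodgeKum4.Theorems.KummerFixedLocusTranslatesOfTransversal
import Literature.AlgebraicGeometry.HodgeTheory.ComplexConjugationHolds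
import Literature.AlgebraicGeometry.HodgeTheory.HodgeIndexHodgeRiemannMiddle
import Literature.AlgebraicGeometry.HodgeTheory.HolomorphicInvolutionGSignature
import Literature.AlgebraicGeometry.HodgeTheory.RealClassesRingChange
import Literature.AlgebraicGeometry.Hyperkaehler.GeneralizedKummerFourHodgeNumbers
import Literature.AlgebraicGeometry.Hyperkaehler.GeneralizedKummerTypeFixedFourfold
import Literature.AlgebraicGeometry.Hyperkaehler.GeneralizedKummerTypeTranslationGroup
import Literature.AlgebraicGeometry.Hyperkaehler.LLVTrivialClassesHodgeType
import Literature.AlgebraicTopology.SingularHomology.CupProductProofs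
import Literature.AlgebraicTopology.SingularHomology.IntegralClassRingChange
import HarnessLib

/-!
# Transport of fixed-point identities between real and complex cohomology of `X(ℂ)`
# (cell `hodge-kum4`, seat p2; bridge for A5 of the `G`-signature route)

HONEST FRAMING.  PROVED plumbing, no named fact: for a `ℂ`-endomorphism `f : X ⟶ X` and a real class
`c ∈ Hᵏ(X(ℂ); ℝ)`, `f^* c = c` iff `f^*(c ⊗ 1) = c ⊗ 1` in `Hᵏ(X(ℂ); ℂ)` — naturality of the change
of coefficients `ℝ → ℂ` (`singularCohomology.ringChange_map`) and its injectivity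
(`ringChange_real_injective`, Hatcher Thm. 3.2).  Consequences: a real class is `Γ(X)`-invariant iff
its complexification is (`IsGammaInvariant`, Statement §1), and the Kummer involution acts trivially
on the real `Γ`-invariant middle classes as soon as it does on the complex ones (A5 over `ℝ` from A5
over `ℂ`, the latter a corollary of L1).
-/

noncomputable section

open CategoryTheory
open Literature.AlgebraicTopology.SingularHomology
open Literature.AlgebraicGeometry Literature.AlgebraicGeometry.HodgeTheory

namespace Summit.Ventures.HodgeKum4

variable {X : Motives.SchemeOver ℂ} {k : ℕ}

/-- Naturality: `(f^* c) ⊗ 1 = f^* (c ⊗ 1)`. -/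
theorem complexify_map (f : X ⟶ X) (c : singularCohomology ℝ ℝ (Motives.ComplexPoints X) k) :
    complexify X k ((singularCohomology.map ℝ ℝ (Motives.AlgPoints.mapContinuous (L := ℂ) f) k).hom c) =
      (complexBetti.map f k).hom (complexify X k c) :=
  singularCohomology.ringChange_map (algebraMap ℝ ℂ) _ c

/-- **`f^* c = c` over `ℝ` iff `f^*(c ⊗ 1) = c ⊗ 1` over `ℂ`.** -/
theorem map_real_eq_self_iff (f : X ⟶ X) (c : singularCohomology ℝ ℝ (Motives.ComplexPoints X) k) :
    (singularCohomology.map ℝ ℝ (Motives.AlgPoints.mapContinuous (L := ℂ) f) k).hom c = c ↔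
      (complexBetti.map f k).hom (complexify X k c) = complexify X k c := by
  rw [← complexify_map, (ringChange_real_injective (Y := Motives.ComplexPoints X)).eq_iff]

/-- **A real class is `Γ(X)`-invariant iff its complexification is** (`IsGammaInvariant` of the
Statement, §1). -/
theorem isGammaInvariant_complexify_iff (c : singularCohomology ℝ ℝ (Motives.ComplexPoints X) k) :
    IsGammaInvariant X (complexify X k c) ↔
      ∀ g : Aut X, g ∈ autFixingH2H3 X →
        (singularCohomology.map ℝ ℝ (Motives.AlgPoints.mapContinuous (L := ℂ) g.hom) k).hom c = c := by
  unfold IsGammaInvariant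
  refine ⟨fun h g hg ↦ (map_real_eq_self_iff g.hom c).2 (h g hg),
    fun h g hg ↦ (map_real_eq_self_iff g.hom c).1 (h g hg)⟩

/-- **A5 over `ℝ` from A5 over `ℂ`.**  If an automorphism `ι` fixes every `Γ(X)`-invariant class of
`H⁸(X(ℂ); ℂ)` (for the Kummer involution: a corollary of L1, `ι^* = (−1)^{deg}` on the `Γ`-invariants),
then it fixes every `Γ(X)`-invariant class of `H⁸(X(ℂ); ℝ)`. -/
theorem map_real_eq_self_of_complex (ι : Aut X)
    (h : ∀ c : complexBetti X k, IsGammaInvariant X c → (complexBetti.map ι.hom k).hom c = c)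
    (c : singularCohomology ℝ ℝ (Motives.ComplexPoints X) k)
    (hc : ∀ g : Aut X, g ∈ autFixingH2H3 X →
      (singularCohomology.map ℝ ℝ (Motives.AlgPoints.mapContinuous (L := ℂ) g.hom) k).hom c = c) :
    (singularCohomology.map ℝ ℝ (Motives.AlgPoints.mapContinuous (L := ℂ) ι.hom) k).hom c = c :=
  (map_real_eq_self_iff ι.hom c).2 (h _ ((isGammaInvariant_complexify_iff c).2 hc))

end Summit.Ventures.HodgeKum4

end

/-!
# Assembly of the input I of L3 from its atoms (cell `hodge-kum4`, seat p2): KERNEL modulo the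
# named facts A0–A5, F_Γℝ and the elementary atom I1

HONEST FRAMING.  Nothing is asserted unconditionally.  For ONE smooth projective `X` of
`Kum⁴`-type this file PROVES the `X`-clause of `Kum4FixedFourfoldClasses` (the cell's `Statement.lean`: an algebraic class `w` and a functional `φ` with `φ(ρ(g)w) = 1` for `g ≠ 1` and `φ(w) ≠ 1`) from:

* the fixed-fourfold datum (A2 + A1, to be vendored: Floccari 2026 Lemma 4.2/Prop 4.6 and the
  `G`-signature theorem, Hirzebruch 1969 (6)): an involution `ι ∈ Aut X` inverting `Γ(X)`, an
  ALGEBRAIC class `w ∈ H⁸(X(ℂ); ℂ)` (the class of `W_X`) and an integer `s` with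
  `Sign(ι, X) = s` (real side, `sig ((realPairing X μ).compl₂ ι^*) = s`) and
  `⟨w ∪ w, [X(ℂ)]⟩ = s` (complex side: `s = [W_X]²`);
* the bookkeeping inputs of `kum4_gSignature_eq_six` (graded commutativity, A0, F_Γℝ, A4, A5, A3),
  which force `s = 6`;
* the elementary atom I1: `⟨w ∪ ρ(g)w, [X(ℂ)]⟩ = 1` for `g ∈ Γ(X) ∖ 1` (`[W_0]·[W_x] = 1`).

The functional is `φ = ⟨w ∪ ·, [X(ℂ)] ⊗ 1⟩` (`complexPairingWith`), `b = 1`, and `φ(w) = 6 ≠ 1`.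
-/

noncomputable section

open CategoryTheory Representation
open Literature.AlgebraicGeometry Literature.AlgebraicGeometry.HodgeTheory
  Literature.AlgebraicGeometry.Hyperkaehler Literature.AlgebraicTopology.SingularHomology

namespace Summit.Ventures.HodgeKum4

/-- **The `X`-clause of input I, assembled.**  For `X` smooth projective of `Kum⁴`-type with an
orientation `μ`, an involution `ι ∈ Aut X` inverting `Γ(X)`, an algebraic class `w ∈ H⁸(X(ℂ); ℂ)`
and an integer `s` such that `Sign(ι, X) = s = ⟨w ∪ w, [X(ℂ)]⟩` (A1 + A2), the bookkeeping inputs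
(graded commutativity, A0, F_Γℝ, A4, A5, A3) and I1 (`⟨w ∪ ρ(g)w, [X(ℂ)]⟩ = 1` for `g ≠ 1`):
there are `w, φ` as required by `Kum4FixedFourfoldClasses` — namely `φ = ⟨w ∪ ·, [X(ℂ)]⟩`, with
`φ(ρ(g)w) = 1` (`g ≠ 1`) and `φ(w) = 6 ≠ 1`. -/
theorem kum4FixedFourfoldClasses_clause_of {X : Motives.SchemeOver ℂ}
    (hX : Motives.IsSmoothProjective 8 X)
    (μ : HomologicalOrientation ℤ (Motives.ComplexPoints X) 16) (ι : Aut X) (hι2 : ι * ι = 1)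
    (hιΓ : ∀ g : Aut X, g ∈ autFixingH2H3 X → ι * g * ι = g⁻¹)
    -- A1 + A2: the fixed fourfold, its class, its self-intersection = the G-signature
    (w : complexBetti X 8) (hw : w ∈ algebraicClasses X 4) (s : ℤ)
    (hA1 : sig ((realPairing X μ).compl₂ (realBetti.map ι.hom 8).hom) = s)
    (hself : complexPairingWith X μ w w = s)
    -- bookkeeping inputs (as in `kum4_gSignature_eq_six`)
    (hcomm : cupProduct_gradedComm ℝ (Motives.ComplexPoints X))
    (hμΓ : ∀ g : Aut X, g ∈ autFixingH2H3 X →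
      singularHomology.map ℝ ℝ (Motives.AlgPoints.mapContinuous (L := ℂ) g.hom) 16
        (realFundamentalClass X μ) = realFundamentalClass X μ)
    (hΓ : Nat.card (autFixingH2H3 X) = 625 ∧
      Module.finrank ℝ (Coinvariants.ker (middleRepReal X)) = 624)
    (hpos : ∀ x ∈ Coinvariants.ker (middleRepReal X), x ≠ 0 → 0 < realPairing X μ x x)
    (hfix : ∀ x ∈ (middleRepReal X).invariants, (realBetti.map ι.hom 8).hom x = x)
    (hσ : sig (realPairing X μ) = 630)
    -- I1: [W_0]·[W_x] = 1
    (hI1 : ∀ g : autFixingH2H3 X, g ≠ 1 → complexPairingWith X μ w (middleRep X g w) = 1) :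
    ∃ (w : complexBetti X 8) (φ : complexBetti X 8 →ₗ[ℂ] ℂ), w ∈ algebraicClasses X 4 ∧
      (∀ g : autFixingH2H3 X, g ≠ 1 → φ (middleRep X g w) = 1) ∧ φ w ≠ 1 := by
  have h6 : s = 6 := by
    rw [← hA1]
    exact kum4_gSignature_eq_six hX μ ι hι2 hιΓ hcomm hμΓ hΓ hpos hfix hσ
  refine ⟨w, complexPairingWith X μ w, hw, hI1, ?_⟩
  rw [hself, h6]
  norm_num


/-- **The `X`-clause of input I, orientation-free assembly.**  With an arbitrary `ℤ`-orientation `μ`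
(sign `ε = ±1` relative to the complex one, produced by the Hodge index / Hodge–Riemann record), the
fixed-fourfold datum (`ι`, the ALGEBRAIC complex class `w` of `W_X`, the real `G`-signature identity
`Sign_μ(ι, X) = s` from A1 with the real/complex bridge `⟨w ∪ w, [X(ℂ)] ⊗ 1⟩ = s`), the bookkeeping
inputs in `ε`-form with only `dim_ℝ 𝒦ℝ ≤ 624`, and I1 in `ε′`-form (`⟨w ∪ ρ(g)w, [X(ℂ)]⟩ = ε′ = ±1`
for `g ≠ 1`): the frozen `Kum4FixedFourfoldClasses` clause holds with `φ = ε′ · ⟨w ∪ ·, [X(ℂ)]⟩`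
(`φ(ρ(g)w) = ε′² = 1`, `|φ(w)| = |s| ≥ 6`). -/
theorem kum4FixedFourfoldClasses_clause_of_eps {X : Motives.SchemeOver ℂ}
    (hX : Motives.IsSmoothProjective 8 X)
    (μ : HomologicalOrientation ℤ (Motives.ComplexPoints X) 16) (ι : Aut X) (hι2 : ι * ι = 1)
    (hιΓ : ∀ g : Aut X, g ∈ autFixingH2H3 X → ι * g * ι = g⁻¹)
    (w : complexBetti X 8) (hw : w ∈ algebraicClasses X 4) (s : ℤ)
    (hA1 : sig ((realPairing X μ).compl₂ (realBetti.map ι.hom 8).hom) = s)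
    (hself : complexPairingWith X μ w w = s)
    (hcomm : cupProduct_gradedComm ℝ (Motives.ComplexPoints X))
    (hμΓ : ∀ g : Aut X, g ∈ autFixingH2H3 X →
      singularHomology.map ℝ ℝ (Motives.AlgPoints.mapContinuous (L := ℂ) g.hom) 16
        (realFundamentalClass X μ) = realFundamentalClass X μ)
    (hcard : Nat.card (autFixingH2H3 X) = 625)
    (hdim : Module.finrank ℝ (Coinvariants.ker (middleRepReal X)) ≤ 624)
    (ε : ℤ) (hε : ε = 1 ∨ ε = -1)
    (hpos : ∀ x ∈ Coinvariants.ker (middleRepReal X), x ≠ 0 → 0 < (ε : ℝ) * realPairing X μ x x)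
    (hfix : ∀ x ∈ (middleRepReal X).invariants, (realBetti.map ι.hom 8).hom x = x)
    (hσ : sig (realPairing X μ) = ε * 630)
    (ε' : ℤ) (hε' : ε' = 1 ∨ ε' = -1)
    (hI1 : ∀ g : autFixingH2H3 X, g ≠ 1 → complexPairingWith X μ w (middleRep X g w) = ε') :
    ∃ (w : complexBetti X 8) (φ : complexBetti X 8 →ₗ[ℂ] ℂ), w ∈ algebraicClasses X 4 ∧
      (∀ g : autFixingH2H3 X, g ≠ 1 → φ (middleRep X g w) = 1) ∧ φ w ≠ 1 := by
  have h6 : 6 ≤ |s| := by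
    rw [← hA1]
    exact six_le_abs_kum4_gSignature hX μ ι hι2 hιΓ hcomm hμΓ hcard hdim ε hε hpos hfix hσ
  refine ⟨w, (ε' : ℂ) • complexPairingWith X μ w, hw, fun g hg => ?_, ?_⟩
  · rw [LinearMap.smul_apply, hI1 g hg, smul_eq_mul]
    rcases hε' with rfl | rfl <;> norm_num
  · rw [LinearMap.smul_apply, hself, smul_eq_mul]
    intro h
    have h' : (ε' : ℤ) * s = 1 := by exact_mod_cast h
    rcases hε' with rfl | rfl
    · rw [one_mul] at h'
      rw [h'] at h6
      norm_num at h6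
    · rw [neg_one_mul] at h'
      have : s = -1 := by omega
      rw [this] at h6
      norm_num at h6

end Summit.Ventures.HodgeKum4

end

/-!
# Crux I (`Kum4FixedFourfoldClasses`) from the printed facts, modulo A5 and I1
(cell `hodge-kum4`, seat p2 — the closing assembly)

HONEST FRAMING.  PROVED: the implication

  (A1) `Hirzebruch1969_gSignature_involution_halfDimFixedLocus`      — `G`-signature theorem
  (A2) `Floccari2026_fixedFourfold_kum4Type`                          — Kummer involution, fixed fourfold
  (A3) `Voisin2002_hodgeIndex_hodgeRiemann_middle` (HI + HR, `ε`-form), `GoettscheSoergel1993_chiY_kum4Type`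
  (A4) `GreenKimLazaRobles2022_llvTrivial_isOfHodgeType_kumType`, `Foster2024_translationAction_kum4Type`
  (F_Γ) `Floccari2026_card_autFixingH2H3_kum4Type`
  (A5) the Kummer involution fixes `H⁸(X(ℂ); ℂ)^Γ` (explicit hypothesis `hA5`; PROVED from André's
       dual-Lefschetz fact + L1 in `KummerFixedLocusKum4NonInvariantClassesAlgebraic`)
  (I1geo) `Kum4FixedFourfoldMeetsTranslates` — THE residual (`W ×_X gW` one reduced point; NOT print,
       cell-proved on paper, HOME/p2/I1-PROOF.md + I1GEO-TRANSPORT.md), through its numerical form I1R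
       `⟨w ∪ ρ(g)w, [X]⟩ = ε' = ±1` (`kum4FixedFourfoldTranslatesR_of_meetsTranslates`, with the printed
       Fulton fact `Fulton1998_cupPairing_transversalPoint`)
  ⟹ `Kum4FixedFourfoldClasses`.

Everything else is kernel-checked: integral Poincaré dual `w` of the fixed fourfold and its
algebraicity (`KummerFixedLocusFixedFourfoldPD`), `Γ` preserves `[X]_ℝ` (odd order,
`KummerFixedLocusOrientationPreserved`), `𝒦 ⊆` LLV-trivial `⊆ H^{4,4}` and `H² ∪ 𝒦 = 0`
(`KummerFixedLocusCoinvariantsLLVTrivial`), the `G`-signature bookkeeping `|Sign(ι, X)| = |630 − dim 𝒦ℝ| ≥ 6`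
(`KummerFixedLocusGSignature`), and the final clause (this file): `φ = ε'·⟨w ∪ ·, [X]⟩`, `φ(ρ(g)w) = 1`,
`φ(w) = ±Sign ≠ 1`.
-/

noncomputable section

open CategoryTheory
open Literature.AlgebraicTopology.SingularHomology
open Literature.AlgebraicGeometry Literature.AlgebraicGeometry.HodgeTheory
open Literature.AlgebraicGeometry.Hyperkaehler (IsOfGeneralizedKummerType translationRep
  translationRepReal Floccari2026_fixedFourfold_kum4Type Floccari2026_card_autFixingH2H3_kum4Type
  Foster2024_translationAction_kum4Type GreenKimLazaRobles2022_llvTrivial_isOfHodgeType_kumType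
  GoettscheSoergel1993_chiY_kum4Type)

namespace Summit.Ventures.HodgeKum4

/-! ### Bridges to the Literature vocabulary (definitional) -/

/-- The real middle representation is the Literature one in degree `8` (same definition). -/
theorem middleRepReal_eq_lit (X : Motives.SchemeOver ℂ) :
    middleRepReal X = translationRepReal X 8 := rfl

/-! ### The closing theorem -/

/-- **Crux I from print, modulo A5 and the geometric residual I1geo.** -/
theorem kum4FixedFourfoldClasses_of_facts
    (hA1 : Hirzebruch1969_gSignature_involution_halfDimFixedLocus)
    (hA2 : Floccari2026_fixedFourfold_kum4Type)
    (hHIR : Voisin2002_hodgeIndex_hodgeRiemann_middle)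
    (hGS : GoettscheSoergel1993_chiY_kum4Type)
    (hGK : GreenKimLazaRobles2022_llvTrivial_isOfHodgeType_kumType)
    (hF : Foster2024_translationAction_kum4Type)
    (hcardF : Floccari2026_card_autFixingH2H3_kum4Type)
    (hA5 : ∀ ⦃X : Motives.SchemeOver ℂ⦄, Motives.IsSmoothProjective 8 X → IsOfGeneralizedKummerType 4 X →
      ∀ ι : Aut X, complexBetti.map ι.hom 2 = 𝟙 _ → complexBetti.map ι.hom 3 = -𝟙 _ →
        ∀ c : complexBetti X 8, IsGammaInvariant X c → (complexBetti.map ι.hom 8).hom c = c)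
    (hFu : Fulton1998_cupPairing_transversalPoint) (hgeo : Kum4FixedFourfoldMeetsTranslates) :
    Summit.Ventures.HodgeKum4.Kum4FixedFourfoldClasses := by
  intro X hX hK
  -- (A2) the Kummer involution and its fixed locus: a Kummer fixed datum `hD`
  obtain ⟨ι, W, i, hD⟩ := hA2 hX hK
  obtain ⟨hι2, hιH2, hιH3, hιΓ, hW, -, hi, hifix, K, hKf, G, dG, iG, hG, hdG, hiG, hGG, hWG,
    hfixlocus⟩ := id hD
  -- the complex orientations and the integral Poincaré dual of `W`
  set μ : HomologicalOrientation ℤ (Motives.ComplexPoints X) 16 := complexOrientationInt hX with hμ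
  set ν : HomologicalOrientation ℤ (Motives.ComplexPoints W) 8 := complexOrientationInt hW with hν
  obtain ⟨w, hw⟩ := exists_int_pdClass hX hW i
  set wR : singularCohomology ℝ ℝ (Motives.ComplexPoints X) 8 :=
    singularCohomology.ringChange (algebraMap ℤ ℝ) (Motives.ComplexPoints X) 8 w with hwR
  set wC : complexBetti X 8 :=
    singularCohomology.ringChange (algebraMap ℤ ℂ) (Motives.ComplexPoints X) 8 w with hwC
  have hwRpd := real_pd_of_int_pd hX hW i hw
  have hwalg : wC ∈ algebraicClasses X 4 := ringChange_int_pdClass_mem_algebraicClasses hX hW i hw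
  set s : ℤ := cupPairing μ (rfl : 8 + 8 = 16) w w with hs
  -- (A1) the `G`-signature theorem: `Sign(ι, X) = ⟨w_ℝ ∪ w_ℝ, [X]_ℝ⟩ = s`
  have hA1' := hA1.dim8 hX μ ι hι2 Unit K (fun _ => W) G dG (fun _ => hW) hG
    (fun k => lt_of_le_of_lt (hdG k) (by norm_num)) (fun _ => i) iG (fun _ => hi) hiG
    (fun j j' hjj' => absurd (Subsingleton.elim j j') hjj') hGG (fun _ k => hWG k)
    (by rw [Set.iUnion_const]; exact hfixlocus) (fun _ => ν) (fun _ => wR) (fun _ => hwRpd)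
  rw [Fintype.sum_unique] at hA1'
  have hBww : (cupProduct (R := ℝ) (X := Motives.ComplexPoints X) (rfl : 8 + 8 = 16)).compr₂
      ((kroneckerPairing ℝ ℝ (Motives.ComplexPoints X) 16).flip
        (singularHomology.coeffChange (Motives.ComplexPoints X)
          (algebraMap ℤ ℝ : ℤ →+* ℝ).toAddMonoidHom 16 μ.fundamentalClass)) wR wR = (s : ℝ) :=
    kroneckerPairing_cup_ringChange_real (rfl : 8 + 8 = 16) μ w w
  have hsig : sig ((realPairing X μ).compl₂ (realBetti.map ι.hom 8).hom) = s := by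
    have h : ((sig ((realPairing X μ).compl₂ (realBetti.map ι.hom 8).hom) : ℤ) : ℝ) = (s : ℝ) := by
      rw [← hBww, ← hA1', sig]
      push_cast
      rfl
    exact_mod_cast h
  have hself : complexPairingWith X μ wC wC = s := by
    rw [complexPairingWith_apply]
    exact kroneckerPairing_cup_ringChange_complex (rfl : 8 + 8 = 16) μ w w
  -- (A3) Hodge index / Hodge–Riemann in `ε`-form
  obtain ⟨ε, hε, hHI, hHR⟩ := hHIR.dim8 hX μ
  obtain ⟨A⟩ := nonempty_hodgeModel_holds (n := 8) (X := X) hX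
  have hσ : sig (realPairing X μ) = ε * 630 := by
    have h := hHI A
    rw [hGS.signatureSum_eq_fst hX hK A] at h
    exact h
  -- (A4) `ε B > 0` on `𝒦ℝ ∖ 0`
  have hpos : ∀ x ∈ Representation.Coinvariants.ker (middleRepReal X), x ≠ 0 →
      0 < (ε : ℝ) * realPairing X μ x x := by
    intro x hx hx0
    rw [middleRepReal_eq_lit] at hx
    exact hHR x hx0 (isOfHodgeType_ringChange_of_mem_coinvariantsKer hGK hF hX hK hx)
      (cup_ringChange_eq_zero_of_mem_coinvariantsKer hF hX hK hx)
  -- (A5) `ι^*` fixes the `Γ`-invariant real middle classes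
  have hfix : ∀ x ∈ (middleRepReal X).invariants, (realBetti.map ι.hom 8).hom x = x := by
    intro x hx
    refine map_real_eq_self_of_complex ι (hA5 hX hK ι hιH2 hιH3) x fun g hg => ?_
    have h := hx (⟨g, hg⟩⁻¹ : autFixingH2H3 X)
    rw [middleRepReal_apply, inv_inv] at h
    exact h
  -- (F_Γ) `|Γ| = 625`, odd; `dim 𝒦ℝ ≤ 624`
  have hcard : Nat.card (autFixingH2H3 X) = 625 := hcardF hX hK
  have hodd : Odd (Nat.card (autFixingH2H3 X)) := by rw [hcard]; exact ⟨312, rfl⟩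
  have hdim : Module.finrank ℝ (Representation.Coinvariants.ker (middleRepReal X)) ≤ 624 := by
    rw [middleRepReal_eq_lit]
    exact (hF hX hK).2.1
  -- (A0) `Γ` preserves `[X]_ℝ`
  have hμΓ : ∀ g : Aut X, g ∈ autFixingH2H3 X →
      singularHomology.map ℝ ℝ (Motives.AlgPoints.mapContinuous (L := ℂ) g.hom) 16
        (realFundamentalClass X μ) = realFundamentalClass X μ :=
    fun g hg => map_realFundamentalClass_eq_self_of_odd_card hX (complexOrientationInt hX)
      (autFixingH2H3 X) hodd g hg
  -- (I1R) on the datum `hD`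
  obtain ⟨ε', hε', hI1'⟩ := kum4FixedFourfoldTranslatesR_of_meetsTranslates hFu hgeo hX hK ι hW i hD w hw
  -- assemble
  exact kum4FixedFourfoldClasses_clause_of_eps hX μ ι hι2 hιΓ wC hwalg s hsig hself
    (cupProduct_gradedComm_holds ℝ (Motives.ComplexPoints X)) hμΓ hcard hdim ε hε hpos hfix hσ ε' hε' hI1'

end Summit.Ventures.HodgeKum4

end
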